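import Mathlib.Algebra.BigOperators.Ring.Finset
import Mathlib.Algebra.Order.BigOperators.Group.Finset
import Mathlib.Data.Real.Basic
import Mathlib.Tactic.Positivity
import Mathlib.Tactic.Linarith
import Mathlib.Tactic.Ring
import Literature.Computability.Complexity.SipserCodingLemma
import HarnessLib

/-!
# Entropy approximation in `Σ₂ᵖ`, III: how often an affine hash hits a set

Third file of the proof of `PEA d ∈ promiseLift (SigmaP 2)`; generic counting facts about the family
of affine maps `w ↦ A w + b`, `A` an `r × N` matrix and `b ∈ F₂^r`, over `F₂` (hash values through
`SipserHash.hashVal`).  For a set `F ⊆ {0,1}^N` let `hit(F) = {(A, b) | ∃ w ∈ F, A w = b}`: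

* `card_hashGraph` — for a fixed `w`, exactly `2^{Nr}` pairs `(A, b)` have `A w = b`;
* **`card_hitSet_le`** — union bound: `|hit(F)| ≤ |F| · 2^{Nr}`;
* `card_hashGraph_inter` — for `w ≠ w'`, exactly `2^{Nr}/2^r` pairs hit both (pairwise independence,
  from `SipserHash.card_agreeM_mul`);
* **`card_missSet_mul_le`** — second moment: `|miss(F)| · |F| ≤ 2^{Nr + 2r}`, i.e. a uniformly random
  affine hash misses `F` with probability at most `2^r / |F|`.

These are the two estimates by which the `NP`-set `S` of the criterion
(`PEASigmaTwoProgram.lean`) is small on YES instances and large on NO instances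
(`PEASigmaTwoCriterion.lean`).

## References

* M. Sipser, *A complexity theoretic approach to randomness*, STOC 1983, §III.
* S. Goldwasser, M. Sipser, *Private coins versus public coins in interactive proof systems*,
  STOC 1986, §4 (the set lower bound protocol: pairwise independent hashing and Chebyshev).
* J. L. Carter, M. N. Wegman, *Universal classes of hash functions*, JCSS 18 (1979).
-/

namespace Literature.Computability.Complexity

open Finset SipserHash

namespace PEAHash

variable {N r : ℕ}

/-- A Boolean vector read in `F₂`. [folklore] -/
def toZv (b : Fin r → Bool) : Fin r → ZMod 2 := fun ρ => if b ρ then 1 else 0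

/-- `toZv` is injective. [folklore] -/
theorem toZv_injective : Function.Injective (toZv (r := r)) := by
  intro b b' h
  funext ρ
  have := congrFun h ρ
  revert this
  simp only [toZv]
  cases b ρ <;> cases b' ρ <;> simp

/-- Every `F₂`-vector is `toZv` of its bits. [folklore] -/
theorem toZv_surjective : Function.Surjective (toZv (r := r)) := by
  intro z
  refine ⟨fun ρ => decide (z ρ = 1), funext fun ρ => ?_⟩
  simp only [toZv]
  have : z ρ = 0 ∨ z ρ = 1 := by generalize z ρ = a; revert a; decide
  rcases this with h | h <;> simp [h]

/-- The pairs `(A, b)` with `A w = b` (the graph of `A ↦ A w`). [folklore] -/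
noncomputable def hashGraph (r : ℕ) (w : Fin N → Bool) : Finset ((Fin r → Fin N → Bool) × (Fin r → Bool)) := by
  classical
  exact univ.filter fun q => hashVal q.1 w = toZv q.2

/-- **`hit(F)`**: the affine hashes `(A, b)` hitting the set `F` (`∃ w ∈ F, A w = b`). [cite: Sipser1983, §III] -/
noncomputable def hitSet (r : ℕ) (F : Finset (Fin N → Bool)) : Finset ((Fin r → Fin N → Bool) × (Fin r → Bool)) := by
  classical
  exact univ.filter fun q => ∃ w ∈ F, hashVal q.1 w = toZv q.2

/-- **`miss(F)`**: the affine hashes missing `F`. [cite: Sipser1983, §III] -/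
noncomputable def missSet (r : ℕ) (F : Finset (Fin N → Bool)) : Finset ((Fin r → Fin N → Bool) × (Fin r → Bool)) := by
  classical
  exact univ.filter fun q => ∀ w ∈ F, hashVal q.1 w ≠ toZv q.2

/-- Membership in `hashGraph`. [folklore] -/
@[simp] theorem mem_hashGraph {w : Fin N → Bool} {q : (Fin r → Fin N → Bool) × (Fin r → Bool)} :
    q ∈ hashGraph r w ↔ hashVal q.1 w = toZv q.2 := by
  classical
  simp [hashGraph]

/-- Membership in `hitSet`. [folklore] -/
@[simp] theorem mem_hitSet {F : Finset (Fin N → Bool)} {q : (Fin r → Fin N → Bool) × (Fin r → Bool)} :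
    q ∈ hitSet r F ↔ ∃ w ∈ F, hashVal q.1 w = toZv q.2 := by
  classical
  simp [hitSet]

/-- Membership in `missSet`. [folklore] -/
@[simp] theorem mem_missSet {F : Finset (Fin N → Bool)} {q : (Fin r → Fin N → Bool) × (Fin r → Bool)} :
    q ∈ missSet r F ↔ ∀ w ∈ F, hashVal q.1 w ≠ toZv q.2 := by
  classical
  simp [missSet]

/-- The number of all affine hashes: `2^{Nr} · 2^r`. [folklore] -/
theorem card_univ_hash :
    (univ : Finset ((Fin r → Fin N → Bool) × (Fin r → Bool))).card = 2 ^ (N * r) * 2 ^ r := by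
  rw [card_univ, Fintype.card_prod, Fintype.card_fun, Fintype.card_fun, Fintype.card_fun,
    Fintype.card_bool, Fintype.card_fin, Fintype.card_fin, ← pow_mul]

/-- `hit` and `miss` partition the hashes. [folklore] -/
theorem card_hitSet_add_card_missSet (F : Finset (Fin N → Bool)) :
    (hitSet r F).card + (missSet r F).card = 2 ^ (N * r) * 2 ^ r := by
  classical
  rw [← card_univ_hash (N := N) (r := r)]
  have h := Finset.card_filter_add_card_filter_not (s := (univ : Finset ((Fin r → Fin N → Bool) × (Fin r → Bool))))
    (p := fun q => ∃ w ∈ F, hashVal q.1 w = toZv q.2)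
  have h1 : (univ.filter fun q : (Fin r → Fin N → Bool) × (Fin r → Bool) => ¬ ∃ w ∈ F, hashVal q.1 w = toZv q.2) =
      missSet r F := by
    ext q; simp
  have h2 : (univ.filter fun q : (Fin r → Fin N → Bool) × (Fin r → Bool) => ∃ w ∈ F, hashVal q.1 w = toZv q.2) =
      hitSet r F := by
    ext q; simp
  rw [h1, h2] at h
  exact h

/-- **For a fixed point, exactly `2^{Nr}` affine hashes map it to the prescribed value** (`b` is
determined by `A`). [cite: Sipser1983, §III] -/
theorem card_hashGraph (w : Fin N → Bool) : (hashGraph r w).card = 2 ^ (N * r) := by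
  classical
  obtain ⟨g, hg⟩ : ∃ g : (Fin r → ZMod 2) → (Fin r → Bool), ∀ z, toZv (g z) = z :=
    ⟨fun z => Classical.choose (toZv_surjective z), fun z => Classical.choose_spec (toZv_surjective z)⟩
  have heq : hashGraph r w = (univ : Finset (Fin r → Fin N → Bool)).image fun A => (A, g (hashVal A w)) := by
    ext ⟨A, b⟩
    simp only [mem_hashGraph, mem_image, mem_univ, true_and, Prod.mk.injEq]
    constructor
    · intro h
      exact ⟨A, rfl, toZv_injective (by rw [hg, h])⟩
    · rintro ⟨A', rfl, rfl⟩
      rw [hg]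
  rw [heq, card_image_of_injective _ fun A A' h => (Prod.mk.injEq _ _ _ _ ▸ h :).1, card_univ,
    Fintype.card_fun, Fintype.card_fun, Fintype.card_bool, Fintype.card_fin, Fintype.card_fin, ← pow_mul]

/-- **Union bound**: `|hit(F)| ≤ |F| · 2^{Nr}`. [cite: Sipser1983, §III] -/
theorem card_hitSet_le (F : Finset (Fin N → Bool)) : (hitSet r F).card ≤ F.card * 2 ^ (N * r) := by
  classical
  have hsub : hitSet r F ⊆ F.biUnion fun w => hashGraph r w := by
    intro q hq
    obtain ⟨w, hw, h⟩ := mem_hitSet.1 hq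
    exact mem_biUnion.2 ⟨w, hw, mem_hashGraph.2 h⟩
  calc (hitSet r F).card ≤ (F.biUnion fun w => hashGraph r w).card := card_le_card hsub
    _ ≤ ∑ w ∈ F, (hashGraph r w).card := card_biUnion_le
    _ = F.card * 2 ^ (N * r) := by simp [card_hashGraph]

/-- **Pairwise independence**: for `w ≠ w'`, the hashes with `A w = b = A w'` number `2^{Nr}/2^r`
(`#· 2^r = 2^{Nr}`): they are the matrices agreeing on `w, w'` (`SipserHash.agreeM`) with `b`
determined. [cite: Sipser1983, §III] -/
theorem card_hashGraph_inter {w w' : Fin N → Bool} (hww' : w ≠ w') :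
    (hashGraph r w ∩ hashGraph r w').card * 2 ^ r = 2 ^ (N * r) := by
  classical
  obtain ⟨g, hg⟩ : ∃ g : (Fin r → ZMod 2) → (Fin r → Bool), ∀ z, toZv (g z) = z :=
    ⟨fun z => Classical.choose (toZv_surjective z), fun z => Classical.choose_spec (toZv_surjective z)⟩
  have heq : hashGraph r w ∩ hashGraph r w' = (agreeM r w w').image fun A => (A, g (hashVal A w)) := by
    ext ⟨A, b⟩
    simp only [mem_inter, mem_hashGraph, mem_image, Prod.mk.injEq, agreeM, mem_filter, mem_univ, true_and]
    constructor
    · rintro ⟨h1, h2⟩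
      exact ⟨A, by rw [h1, h2], rfl, toZv_injective (by rw [hg, h1])⟩
    · rintro ⟨A', hA', rfl, rfl⟩
      rw [hg]
      exact ⟨rfl, hA'.symm⟩
  rw [heq, card_image_of_injective _ fun A A' h => (Prod.mk.injEq _ _ _ _ ▸ h :).1]
  exact card_agreeM_mul r hww'

/-! ### The second moment of the number of hit points -/

/-- The number of points of `F` hit by `(A, b)`. [folklore] -/
noncomputable def hits (F : Finset (Fin N → Bool)) (q : (Fin r → Fin N → Bool) × (Fin r → Bool)) : ℕ := by
  classical
  exact (F.filter fun w => hashVal q.1 w = toZv q.2).card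

/-- `Σ_{(A,b)} hits = |F| · 2^{Nr}` (linearity). [cite: GoldwasserSipser1986, §4] -/
theorem sum_hits (F : Finset (Fin N → Bool)) :
    ∑ q : (Fin r → Fin N → Bool) × (Fin r → Bool), hits F q = F.card * 2 ^ (N * r) := by
  classical
  unfold hits
  simp only [card_eq_sum_ones, sum_filter]
  rw [sum_comm]
  have : ∀ w ∈ F, ∑ q : (Fin r → Fin N → Bool) × (Fin r → Bool), (if hashVal q.1 w = toZv q.2 then 1 else 0) =
      2 ^ (N * r) := by
    intro w _
    rw [← sum_filter, ← card_eq_sum_ones]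
    exact card_hashGraph (r := r) w ▸ by congr 1
  rw [sum_congr rfl this, sum_const, smul_eq_mul, ← card_eq_sum_ones]

/-- `Σ_{(A,b)} hits² · 2^r = |F| · 2^{Nr} · 2^r + |F| (|F| - 1) · 2^{Nr}` (pairwise independence).
[cite: GoldwasserSipser1986, §4] -/
theorem sum_hits_sq_mul (F : Finset (Fin N → Bool)) :
    (∑ q : (Fin r → Fin N → Bool) × (Fin r → Bool), hits F q ^ 2) * 2 ^ r =
      F.card * 2 ^ (N * r) * 2 ^ r + F.card * (F.card - 1) * 2 ^ (N * r) := by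
  classical
  -- `hits² = Σ_{w, w' ∈ F} [A w = b] [A w' = b]`
  have hsq : ∀ q : (Fin r → Fin N → Bool) × (Fin r → Bool), hits F q ^ 2 =
      ∑ w ∈ F, ∑ w' ∈ F, if hashVal q.1 w = toZv q.2 ∧ hashVal q.1 w' = toZv q.2 then 1 else 0 := by
    intro q
    unfold hits
    rw [sq, card_eq_sum_ones, sum_filter, sum_mul_sum]
    refine sum_congr rfl fun w _ => sum_congr rfl fun w' _ => ?_
    by_cases h1 : hashVal q.1 w = toZv q.2 <;> by_cases h2 : hashVal q.1 w' = toZv q.2 <;> simp [h1, h2]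
  simp only [hsq]
  rw [sum_comm]
  simp only [sum_comm (s := (univ : Finset ((Fin r → Fin N → Bool) × (Fin r → Bool)))) (t := F)]
  -- inner sums are cardinalities of (intersections of) graphs
  have hinner : ∀ w ∈ F, ∀ w' ∈ F,
      (∑ q : (Fin r → Fin N → Bool) × (Fin r → Bool),
          (if hashVal q.1 w = toZv q.2 ∧ hashVal q.1 w' = toZv q.2 then 1 else 0)) * 2 ^ r =
        if w = w' then 2 ^ (N * r) * 2 ^ r else 2 ^ (N * r) := by
    intro w _ w' _
    rw [← sum_filter, ← card_eq_sum_ones]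
    have hset : (univ.filter fun q : (Fin r → Fin N → Bool) × (Fin r → Bool) =>
        hashVal q.1 w = toZv q.2 ∧ hashVal q.1 w' = toZv q.2) = hashGraph r w ∩ hashGraph r w' := by
      ext q; simp
    rw [hset]
    by_cases hww' : w = w'
    · subst hww'
      rw [if_pos rfl, inter_self, card_hashGraph]
    · rw [if_neg hww', card_hashGraph_inter hww']
  rw [sum_mul, sum_congr rfl fun w hw => by rw [sum_mul, sum_congr rfl fun w' hw' => hinner w hw w' hw']]
  -- evaluate the double sum of the two-valued function
  have hdiag : ∀ w ∈ F, ∑ w' ∈ F, (if w = w' then 2 ^ (N * r) * 2 ^ r else 2 ^ (N * r)) =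
      2 ^ (N * r) * 2 ^ r + (F.card - 1) * 2 ^ (N * r) := by
    intro w hw
    rw [← add_sum_erase F _ hw, if_pos rfl]
    congr 1
    rw [sum_congr rfl fun w' hw' => if_neg (ne_of_mem_erase hw').symm, sum_const, smul_eq_mul,
      card_erase_of_mem hw]
  rw [sum_congr rfl hdiag, sum_const, smul_eq_mul]
  ring

/-- **Second moment bound**: `|miss(F)| · |F| ≤ 2^{Nr + 2r}` — a uniformly random affine hash of
`r` rows misses a set `F` with probability at most `2^r/|F|` (Chebyshev with pairwise independence,
as in the Goldwasser–Sipser set lower bound protocol). [cite: GoldwasserSipser1986, §4] -/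
theorem card_missSet_mul_le (F : Finset (Fin N → Bool)) :
    (missSet r F).card * F.card ≤ 2 ^ (N * r) * 2 ^ r * 2 ^ r := by
  classical
  rcases Nat.eq_zero_or_pos F.card with h0 | hpos
  · simp [h0]
  -- work over `ℝ` with `D = 2^r · hits - |F|`; on `miss`, `D² = |F|²`
  have key : ((missSet r F).card : ℝ) * (F.card : ℝ) ^ 2 ≤
      ∑ q : (Fin r → Fin N → Bool) × (Fin r → Bool), ((2 : ℝ) ^ r * hits F q - F.card) ^ 2 := by
    have hmiss : ∀ q ∈ missSet r F, ((2 : ℝ) ^ r * hits F q - F.card) ^ 2 = (F.card : ℝ) ^ 2 := by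
      intro q hq
      have : hits F q = 0 := by
        unfold hits
        rw [card_eq_zero, filter_eq_empty_iff]
        exact fun w hw => mem_missSet.1 hq w hw
      rw [this]; push_cast; ring
    calc ((missSet r F).card : ℝ) * (F.card : ℝ) ^ 2 = ∑ q ∈ missSet r F, ((2 : ℝ) ^ r * hits F q - F.card) ^ 2 := by
          rw [sum_congr rfl hmiss, sum_const, nsmul_eq_mul]
      _ ≤ ∑ q, ((2 : ℝ) ^ r * hits F q - F.card) ^ 2 :=
          sum_le_sum_of_subset_of_nonneg (subset_univ _) fun q _ _ => sq_nonneg _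
  -- expand the sum of squares with the two moment identities
  have h1 : ∑ q : (Fin r → Fin N → Bool) × (Fin r → Bool), (hits F q : ℝ) = F.card * (2 : ℝ) ^ (N * r) := by
    exact_mod_cast sum_hits (r := r) F
  have h2 : (∑ q : (Fin r → Fin N → Bool) × (Fin r → Bool), (hits F q : ℝ) ^ 2) * (2 : ℝ) ^ r =
      F.card * (2 : ℝ) ^ (N * r) * (2 : ℝ) ^ r + F.card * ((F.card : ℝ) - 1) * (2 : ℝ) ^ (N * r) := by
    have := sum_hits_sq_mul (r := r) F
    have hc : ((F.card - 1 : ℕ) : ℝ) = (F.card : ℝ) - 1 := by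
      rw [Nat.cast_sub (by omega)]; simp
    rw [← hc]
    exact_mod_cast this
  have hΩ : ((univ : Finset ((Fin r → Fin N → Bool) × (Fin r → Bool))).card : ℝ) = (2 : ℝ) ^ (N * r) * (2 : ℝ) ^ r := by
    exact_mod_cast card_univ_hash (N := N) (r := r)
  have hexp : ∑ q : (Fin r → Fin N → Bool) × (Fin r → Bool), ((2 : ℝ) ^ r * hits F q - F.card) ^ 2 =
      (2 : ℝ) ^ r * ((∑ q : (Fin r → Fin N → Bool) × (Fin r → Bool), (hits F q : ℝ) ^ 2) * (2 : ℝ) ^ r) -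
        2 * (2 : ℝ) ^ r * F.card * (∑ q : (Fin r → Fin N → Bool) × (Fin r → Bool), (hits F q : ℝ)) +
        ((univ : Finset ((Fin r → Fin N → Bool) × (Fin r → Bool))).card : ℝ) * (F.card : ℝ) ^ 2 := by
    have : ∀ q : (Fin r → Fin N → Bool) × (Fin r → Bool), ((2 : ℝ) ^ r * hits F q - F.card) ^ 2 =
        (2 : ℝ) ^ r * (2 : ℝ) ^ r * (hits F q : ℝ) ^ 2 - 2 * (2 : ℝ) ^ r * F.card * hits F q + (F.card : ℝ) ^ 2 := by
      intro q; ring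
    simp only [this, sum_add_distrib, sum_sub_distrib, ← mul_sum, sum_const, nsmul_eq_mul]
    ring
  rw [hexp, h2, h1, hΩ] at key
  -- `key : miss · |F|² ≤ |F| 2^{Nr} 2^{2r} - |F| 2^{Nr} 2^r ≤ |F| 2^{Nr} 2^{2r}`
  have hF : (0 : ℝ) < F.card := by exact_mod_cast hpos
  have key' : ((missSet r F).card : ℝ) * F.card ≤ (2 : ℝ) ^ (N * r) * (2 : ℝ) ^ r * (2 : ℝ) ^ r := by
    have hle : ((missSet r F).card : ℝ) * (F.card : ℝ) ^ 2 ≤ (F.card : ℝ) * ((2 : ℝ) ^ (N * r) * (2 : ℝ) ^ r * (2 : ℝ) ^ r) := by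
      refine key.trans ?_
      have : (0 : ℝ) ≤ (F.card : ℝ) * (2 : ℝ) ^ (N * r) * (2 : ℝ) ^ r := by positivity
      nlinarith
    rw [sq, ← mul_assoc, mul_comm (F.card : ℝ) ((2 : ℝ) ^ (N * r) * _ * _)] at hle
    exact le_of_mul_le_mul_right hle hF
  exact_mod_cast key'

end PEAHash

end Literature.Computability.Complexity
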